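import Summits.AtomisticToContinuum.BoseEinsteinCondensation.Theorems.BECThomsonPrincipleGDTransferSeededDefs
import Summits.AtomisticToContinuum.BoseEinsteinCondensation.Theorems.BECThomsonPrincipleGDTransferChordVariationSrcPair
import Literature.Barriers.AtomisticToContinuum.KineticGapLengthScalesScaling

/-!
# Route `BECThomsonPrinciple`, crux `GDTransfer` (stmt-AtomisticToContinuum-9482), line `seeded-continuity` —
# registered stub `stub_localConstancy`, part 1: the `Q_S`-masses are dilation invariant

Supports (does not close) stmt-AtomisticToContinuum-9482; helper file of `stub_localConstancy`
(`Theorems/BECThomsonPrincipleGDTransferSeededLocalConstancy.lean`).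

The dilation `Ψ ↦ b^{-3N/2}Ψ(·/b)` of the torus of side `M` onto the torus of side `bM`
(`PeriodicTrialState.dilate`, `Literature/Barriers/AtomisticToContinuum/KineticGapLengthScalesScaling.lean`)
commutes with the crux's cell averages `P_i` (`cellAvg_comp_inv_smul`: substitute `y = b y'` in the cell
integral, `(bM)⁻³ b³ = M⁻³`), hence with every `Q_S = Π_{i∈S}P_i Π_{i∉S}(1 - P_i)` (`modeProj_comp_inv_smul`,
induction along the crux's `foldr`), so `Q_S(Ψ_b) = b^{-3N/2} (Q_S Ψ)(·/b)` (`modeProj_dilate`) and the masses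
`∫_{cell^N} |Q_S Ψ|²` are dilation invariant (`lintegral_modeProj_dilate_sq`; the `Q_S`-analogue of the tree's
`condensateOccupation_dilate`).  In the vocabulary of the line: `compMass`, `lawMass`, `hiMass` of the dilated
state equal those of the state (`seeded_compMass_dilate`, `lawMass_dilate`, `hiMass_dilate`).  All [folklore].
-/

noncomputable section

open MeasureTheory Filter Set
open scoped ENNReal NNReal

namespace Summit.AtomisticToContinuum.BoseEinsteinCondensation.Cruxes.GDTransfer.Seeded

open Literature.MathematicalPhysics.QuantumManyBody.BoseGas
open Literature.Barriers.AtomisticToContinuum.BoseGas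
open Summit.AtomisticToContinuum.BoseEinsteinCondensation.Theorems.GaussianDominationCan.Negative (modeProj cellAvg)
open Summit.AtomisticToContinuum.BoseEinsteinCondensation.Cruxes.GDTransfer.DysonDressedWitness.ChordVariation
  (modeProj_const_mul)

variable {N : ℕ}

/-! ## `P_i` and `Q_S` commute with dilations -/

/-- **`P_i` commutes with the dilation `X ↦ X/b`**: `P_i^{(bM)}(g(·/b)) = (P_i^{(M)} g)(·/b)`
(substitution `y = b y'` in the cell integral and `(bM)⁻³ b³ = M⁻³`). [folklore] -/
theorem cellAvg_comp_inv_smul {b : ℝ} (hb : 0 < b) (M : ℝ) (i : Fin N) (g : Config N → ℂ) :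
    cellAvg N (b * M) i (fun X => g (b⁻¹ • X)) = fun X => cellAvg N M i g (b⁻¹ • X) := by
  funext X
  simp only [cellAvg, ← Function.update_smul]
  rw [setIntegral_cell_comp_inv_smul hb M (fun y => g (Function.update (b⁻¹ • X) i y)),
    Complex.real_smul, Complex.real_smul, ← mul_assoc, ← Complex.ofReal_mul]
  have key : ((b * M) ^ 3)⁻¹ * b ^ 3 = (M ^ 3)⁻¹ := by
    rw [mul_pow, mul_inv, mul_assoc, mul_comm (M ^ 3)⁻¹, ← mul_assoc,
      inv_mul_cancel₀ (pow_ne_zero 3 hb.ne'), one_mul]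
  rw [key]

/-- The crux's `foldr` of `P_i` / `1 - P_i` commutes with the dilation. [folklore] -/
theorem foldr_cellAvg_comp_inv_smul {b : ℝ} (hb : 0 < b) (M : ℝ) (S : Finset (Fin N))
    (l : List (Fin N)) (g : Config N → ℂ) :
    l.foldr (fun i h => if i ∈ S then cellAvg N (b * M) i h else h - cellAvg N (b * M) i h)
        (fun X => g (b⁻¹ • X)) =
      fun X => l.foldr (fun i h => if i ∈ S then cellAvg N M i h else h - cellAvg N M i h) g
        (b⁻¹ • X) := by
  induction l with
  | nil => rfl
  | cons a l ih =>
    simp only [List.foldr_cons]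
    rw [ih]
    by_cases haS : a ∈ S
    · simp only [if_pos haS]
      exact cellAvg_comp_inv_smul hb M a _
    · simp only [if_neg haS]
      rw [cellAvg_comp_inv_smul hb M a _]
      rfl

/-- **`Q_S` commutes with the dilation**: `Q_S^{(bM)}(g(·/b)) = (Q_S^{(M)} g)(·/b)`. [folklore] -/
theorem modeProj_comp_inv_smul {b : ℝ} (hb : 0 < b) (M : ℝ) (S : Finset (Fin N))
    (g : Config N → ℂ) :
    modeProj N (b * M) S (fun X => g (b⁻¹ • X)) = fun X => modeProj N M S g (b⁻¹ • X) :=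
  foldr_cellAvg_comp_inv_smul hb M S _ g

/-- **`Q_S` of the dilated state**: `Q_S(b^{-3N/2}Ψ(·/b)) = b^{-3N/2}(Q_S Ψ)(·/b)`. [folklore] -/
theorem modeProj_dilate {M M' b : ℝ} (hb : 0 < b) (hM : M' = b * M) (S : Finset (Fin N))
    (Φ : PeriodicTrialState N M) :
    modeProj N M' S (Φ.dilate b hb hM).ψ =
      fun X => (dilateConst b N : ℂ) * modeProj N M S Φ.ψ (b⁻¹ • X) := by
  subst hM
  show modeProj N (b * M) S (fun X => (dilateConst b N : ℂ) * Φ.ψ (b⁻¹ • X)) = _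
  rw [modeProj_const_mul S (dilateConst b N : ℂ) (fun Y => Φ.ψ (b⁻¹ • Y)),
    modeProj_comp_inv_smul hb M S Φ.ψ]

/-- **The `Q_S`-masses are dilation invariant**: `∫_{[0,bM)^{3N}} |Q_S Ψ_b|² = ∫_{[0,M)^{3N}} |Q_S Ψ|²`
for `Ψ_b = b^{-3N/2}Ψ(·/b)` (the `Q_S`-analogue of `condensateOccupation_dilate`). [folklore] -/
theorem lintegral_modeProj_dilate_sq {M M' b : ℝ} (hb : 0 < b) (hM : M' = b * M)
    (S : Finset (Fin N)) (Φ : PeriodicTrialState N M) :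
    ∫⁻ X in cellN N M', (‖modeProj N M' S (Φ.dilate b hb hM).ψ X‖₊ : ℝ≥0∞) ^ 2 =
      ∫⁻ X in cellN N M, (‖modeProj N M S Φ.ψ X‖₊ : ℝ≥0∞) ^ 2 := by
  rw [modeProj_dilate hb hM S Φ]
  subst hM
  simp only [nnnorm_real_mul_sq (dilateConst_pos hb N).le]
  rw [lintegral_const_mul' _ _ ENNReal.ofReal_ne_top,
    setLIntegral_cellN_comp_inv_smul hb M (fun X => (‖modeProj N M S Φ.ψ X‖₊ : ℝ≥0∞) ^ 2),
    ← mul_assoc, ofReal_dilateConst_sq_mul hb, one_mul]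

/-! ## The law of the dilated state -/

/-- **The component masses `w_S` are dilation invariant** (registered helper of `stub_localConstancy`):
`compMass` at side `L₁ = bL'` of the dilated state equals `compMass` at side `L'` of the state. [folklore] -/
theorem seeded_compMass_dilate : ∀ (m : ℕ) (L' L₁ b : ℝ) (hb : 0 < b) (hL : L₁ = b * L') (S : Finset (Fin (m + 1))) (Ψ' : Literature.MathematicalPhysics.QuantumManyBody.BoseGas.PeriodicTrialState (m + 1) L'), compMass m L₁ S (Ψ'.dilate b hb hL).ψ = compMass m L' S Ψ'.ψ :=
  fun _ _ _ _ hb hL S Ψ' => lintegral_modeProj_dilate_sq hb hL S Ψ'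

/-- Every partial law `Σ_{|S| ∈ A} w_S` is dilation invariant. [folklore] -/
theorem lawMass_dilate {m : ℕ} {L' L₁ b : ℝ} (hb : 0 < b) (hL : L₁ = b * L') (p : ℕ → Prop)
    [DecidablePred p] (Ψ' : PeriodicTrialState (m + 1) L') :
    lawMass m L₁ p (Ψ'.dilate b hb hL).ψ = lawMass m L' p Ψ'.ψ :=
  Finset.sum_congr rfl fun S _ => seeded_compMass_dilate m L' L₁ b hb hL S Ψ'

/-- The condensed-side mass `P(n̂₀ ≥ (1-β)N)` is dilation invariant. [folklore] -/
theorem hiMass_dilate {m : ℕ} {L' L₁ b : ℝ} (hb : 0 < b) (hL : L₁ = b * L') (β : ℝ)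
    (Ψ' : PeriodicTrialState (m + 1) L') :
    hiMass m L₁ β (Ψ'.dilate b hb hL).ψ = hiMass m L' β Ψ'.ψ :=
  lawMass_dilate hb hL _ Ψ'

/-- The depleted-side mass `P(n̂₀ < θN)` is dilation invariant. [folklore] -/
theorem loMass_dilate {m : ℕ} {L' L₁ b : ℝ} (hb : 0 < b) (hL : L₁ = b * L') (θ : ℝ)
    (Ψ' : PeriodicTrialState (m + 1) L') :
    loMass m L₁ θ (Ψ'.dilate b hb hL).ψ = loMass m L' θ Ψ'.ψ :=
  lawMass_dilate hb hL _ Ψ'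

end Summit.AtomisticToContinuum.BoseEinsteinCondensation.Cruxes.GDTransfer.Seeded

end
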